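import Summits.QuantumFields.BalabanUV.T4Continuum.Support.NE3FramePotBoundWClass
import Summits.QuantumFields.BalabanUV.T4Continuum.Support.NE3CurvedFrameKill
import HarnessLib

/-!
# T⁴ programme, node NE3, route Π row Π-D — THE LINEARISED k-FOLD AVERAGE `D_W := dirIter L k W` IN ℓ²(TORUS): WHAT IS TRUE
# (i) on FRAME-FREE fields (`framePotW = 0`, e.g. the slice `T_♮(W)`): `l2sq (D_W Y) ≤ 4·M^{2−d}·l2sq Y`, class only;
# (ii) in general a TWO-TERM bound `≤ 8·M^{2−d}·l2sq Y + 384·d²·L·l2sq Y` — the frame part does NOT decay in `M` (F-ne3leaf04g6-1)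

NE3 formalisation swarm `b2b-balaban-t4-ne3-formalise-*`, LEAF PROVER 04 (gen 6), row Π-D of the owner's design note `HOME/t4/b2b-balaban-t4-ne3-p1/g24/D-ne3p1-g24-1.md`
§6 (ruling ρ-g24-2; «natural holder: leaf-04 (tower kit author)»).  The note typed `‖D_W Z‖² ≤ 2·M^{2−d}‖Z‖²` for the linearised k-fold average on
ALL bond fields; this seat's FINDING F-ne3leaf04g6-1 (journal) refutes that for general `Z` (a pure gauge direction generated by a point charge at a block
corner is seen by the average at full strength: ratio ONE, by gauge covariance — this lineage's `cpush_gaugeDir` ∕ `dirIter_gaugeDir`).  WHAT IS TRUE, in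
the kernel, over landed names only: by the STRUCTURE THEOREM of this lineage's w4-S `NE3TangentCovariantTower.dirIter_eq_QbarIter_add_gaugeDir`
(`dirIter = QbarIter + gaugeDir (cavgIter) (framePotW)`), the straight part decays (`NE3FramePotBoundWClass.l2sq_QbarIter_le_class`: `4·(L²∕L^d)^k`, tower
class `LevelSmall` only — this seat's C1-L2♯), and the frame part is bounded WITHOUT decay by the class-only frame bound H4-W♯♯
(`NE3FramePotBoundWClass.sum_norm_framePotW_sq_le_class`: `48·(d·L)`) times the elementary `l2sq (gaugeDir U f) ≤ 4d·Σ‖f‖²`.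

PACKAGE INDEX of row Π-D (ruling ρ-g24-3 (3)) — the linear map `D_W` and its calculus are ALREADY IN THE TREE and are used BY NAME, not restated:
`NE3TangentCovariantTower.dirIter` (`D_W^{(k)} := dirIter L k W`), `dirIter_zero`, `dirIter_add` (additivity), `dirIter_gaugeDir` (covariance on pure gauge
directions), `dirIter_add_gaugeDir`, `tangentIter_iff_dirIter_eq_zero` (the dictionary `TangentIter L j W Y ↔ dirIter L (j+1) W Y = 0`), and the structure
theorem `dirIter_eq_QbarIter_add_gaugeDir`; the kernel witness that NO `M`-decay holds for general `Z` is `NE3LinearisedAverageGaugeSpike` (Π-D-neg).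

CONTENT (all [folklore]; 0 sorry; 0 def):
§1 `l2sq_gaugeDir_le` (unitary `U`, `N`-periodic site field `f`: `l2sq (periodBox N) (gaugeDir U f) ≤ 4·d·Σ_{z∈periodBox N} ‖f z‖²`); `l2sq_add_le`;
§2 **`l2sq_dirIter_le_of_frameFree`** (class + `framePotW L (j+1) W Y = 0` ⇒ `l2sq_N (dirIter L (j+1) W Y) ≤ 4·(L²∕L^d)^{j+1}·l2sq_{tower L N (j+1)} Y`) and
   the dictionary restated `dirIter_eq_zero_of_tangentIter` (`TangentIter L j W Y → dirIter L (j+1) W Y = 0`, `tangentIter_iff_dirIter_eq_zero` BY NAME);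
§3 **`l2sq_dirIter_le_two_term`** (`3 ≤ d`, `2 ≤ L`, class: `l2sq_N (dirIter L (j+1) W Y) ≤ 8·(L²∕L^d)^{j+1}·l2sq Y + 8·d·(48·(d·L))·l2sq Y`).

HONEST FRAMING.  Lattice kinematics on OUR frame (the correct ℓ² sizes of an object of route Π's future dischargers Π-R∕Π-C); nothing about Bałaban's
minimisers; the endpoint chart, (P♮)_W, (ML_w) at W ≠ 1, T-E_w and NE3 are NOT proved; spine PROVED 0∕9; finite T⁴ rung (B)+1 — NOT infinite volume, NOT
mass gap, NOT BetaPertH, NOT Clay.  ABSOLUTE RULE kept (no printed sentence is a hypothesis; context only: [Balaban1985Averaging] (42)–(48), (120)).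
PLACEMENT: `Summits/QuantumFields/BalabanUV/`.
HONEST DEPENDENCY: continuum YM on T⁴ ⇐ BetaPertH ∧ nine spine estimates (0/9 proved); BetaPertH ⇐ (D1) ∧ (D4) ∧ CAP+tail; G-an2-4 gates asym, D1 and NE2/3/4.
-/

set_option autoImplicit false

open scoped BigOperators Matrix.Norms.L2Operator
open Finset

namespace Summit.QuantumFields.BalabanUV.T4Continuum.NE3LinearisedAverageL2

open Literature.MathematicalPhysics.QuantumFieldTheory.Balaban1983to89
open B7Prop1Explicit B7Prop2Explicit
open T4AveragingDeficitWall (IsUnitaryCfg IsSkewDir SmallField Ad)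
open T4AveragingDeficitWallBoundary (periodBox IsPeriodicCfg sum_periodBox_shift)
open AveragingDeficitPeriodicCounting (IsPeriodicDir)
open AveragingDeficitTransport (norm_Ad_of_unitary)
open AveragingDeficitMultiLevelPrep (cavgIter tower LevelSmall TangentIter cavgIter_unitary_small natCast_tower_succ)
open BlockAveragePushDirGauge (gaugeDir)
open NE3TangentCovariantTower (dirIter QbarIter framePotW dirIter_eq_QbarIter_add_gaugeDir tangentIter_iff_dirIter_eq_zero)
open NE3CovariantLineSumsL2 (l2sq l2sq_nonneg sqrt_l2sq_add_le)
open NE3FramePotBoundW (tower_eq_pow_mul levelSmall_of_le)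
open NE3FramePotBoundWClass (l2sq_QbarIter_succ_le_class sum_norm_framePotW_sq_le_class)
open NE3CurvedFrameKill (framePotW_skew_periodic)

noncomputable section

variable {d : ℕ} {n : Type*} [Fintype n] [DecidableEq n]

/-! ## §1 The ℓ² size of a gauge direction and a two-term Minkowski -/

/-- **THE ℓ² SIZE OF A GAUGE DIRECTION**: for unitary `U` and an `N`-periodic site field `f`,
`l2sq (periodBox N) (gaugeDir U f) ≤ 4·d·Σ_{z∈periodBox N} ‖f z‖²` (`‖Ad_{U⁻¹} f(z) − f(z+e_κ)‖² ≤ 2‖f z‖² + 2‖f (z+e_κ)‖²`, shift invariance). [folklore] -/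
theorem l2sq_gaugeDir_le [Nonempty n] {N : ℕ} (hN : 1 ≤ N) {U : Site d → Fin d → (Matrix n n ℂ)ˣ} (hU : IsUnitaryCfg U)
    {f : Site d → Matrix n n ℂ} (hf : ∀ (z : Site d) (i : Fin d), f (z + (N : ℤ) • e i) = f z) :
    l2sq (periodBox (d := d) N) (gaugeDir U f) ≤ 4 * (d : ℝ) * ∑ z ∈ periodBox (d := d) N, ‖f z‖ ^ 2 := by
  unfold l2sq
  have hpt : ∀ (z : Site d) (κ : Fin d), ‖gaugeDir U f z κ‖ ^ 2 ≤ 2 * ‖f z‖ ^ 2 + 2 * ‖f (z + e κ)‖ ^ 2 := by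
    intro z κ
    have hu : (U z κ)⁻¹ ∈ unitaryUnits (Matrix n n ℂ) := (unitaryUnits (Matrix n n ℂ)).inv_mem (hU z κ)
    have h1 : ‖gaugeDir U f z κ‖ ≤ ‖f z‖ + ‖f (z + e κ)‖ := by
      unfold gaugeDir
      exact (norm_sub_le _ _).trans (by rw [norm_Ad_of_unitary hu])
    have h0 : 0 ≤ ‖gaugeDir U f z κ‖ := norm_nonneg _
    nlinarith [sq_nonneg (‖f z‖ - ‖f (z + e κ)‖), norm_nonneg (f z), norm_nonneg (f (z + e κ))]
  have hg : ∀ (z : Site d) (i : Fin d), (fun y => ‖f y‖ ^ 2) (z + (N : ℤ) • e i) = (fun y => ‖f y‖ ^ 2) z := fun z i => by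
    simp only [hf z i]
  have hA : ∑ z ∈ periodBox (d := d) N, ∑ _κ : Fin d, 2 * ‖f z‖ ^ 2 = 2 * (d : ℝ) * ∑ z ∈ periodBox (d := d) N, ‖f z‖ ^ 2 := by
    rw [Finset.mul_sum]
    refine Finset.sum_congr rfl fun z _ => ?_
    rw [Finset.sum_const, Finset.card_univ, Fintype.card_fin, nsmul_eq_mul]
    ring
  have hB : ∑ z ∈ periodBox (d := d) N, ∑ κ : Fin d, 2 * ‖f (z + e κ)‖ ^ 2 = 2 * (d : ℝ) * ∑ z ∈ periodBox (d := d) N, ‖f z‖ ^ 2 := by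
    rw [Finset.sum_comm]
    have hκ : ∀ κ : Fin d, ∑ z ∈ periodBox (d := d) N, 2 * ‖f (z + e κ)‖ ^ 2 = 2 * ∑ z ∈ periodBox (d := d) N, ‖f z‖ ^ 2 := by
      intro κ
      rw [← Finset.mul_sum, sum_periodBox_shift N hN (g := fun y => ‖f y‖ ^ 2) hg (e κ)]
    rw [Finset.sum_congr rfl fun κ _ => hκ κ, Finset.sum_const, Finset.card_univ, Fintype.card_fin, nsmul_eq_mul]
    ring
  calc ∑ z ∈ periodBox (d := d) N, ∑ κ : Fin d, ‖gaugeDir U f z κ‖ ^ 2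
      ≤ ∑ z ∈ periodBox (d := d) N, ∑ κ : Fin d, (2 * ‖f z‖ ^ 2 + 2 * ‖f (z + e κ)‖ ^ 2) :=
        Finset.sum_le_sum fun z _ => Finset.sum_le_sum fun κ _ => hpt z κ
    _ = ∑ z ∈ periodBox (d := d) N, ∑ _κ : Fin d, 2 * ‖f z‖ ^ 2 + ∑ z ∈ periodBox (d := d) N, ∑ κ : Fin d, 2 * ‖f (z + e κ)‖ ^ 2 := by
        rw [← Finset.sum_add_distrib]
        exact Finset.sum_congr rfl fun z _ => Finset.sum_add_distrib
    _ = 4 * (d : ℝ) * ∑ z ∈ periodBox (d := d) N, ‖f z‖ ^ 2 := by rw [hA, hB]; ring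

/-- Two-term Minkowski, squared: `l2sq F (Y + Z) ≤ 2·l2sq F Y + 2·l2sq F Z`. [folklore] -/
theorem l2sq_add_le (F : Finset (Site d)) (Y Z : Site d → Fin d → Matrix n n ℂ) :
    l2sq F (fun z κ => Y z κ + Z z κ) ≤ 2 * l2sq F Y + 2 * l2sq F Z := by
  unfold l2sq
  rw [Finset.mul_sum, Finset.mul_sum, ← Finset.sum_add_distrib]
  refine Finset.sum_le_sum fun z _ => ?_
  rw [Finset.mul_sum, Finset.mul_sum, ← Finset.sum_add_distrib]
  refine Finset.sum_le_sum fun κ _ => ?_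
  have h := norm_add_le (Y z κ) (Z z κ)
  have h0 : 0 ≤ ‖Y z κ + Z z κ‖ := norm_nonneg _
  nlinarith [sq_nonneg (‖Y z κ‖ - ‖Z z κ‖), norm_nonneg (Y z κ), norm_nonneg (Z z κ)]

/-! ## §2 Frame-free fields: the straight decay -/

/-- THE DICTIONARY (this lineage's `tangentIter_iff_dirIter_eq_zero` BY NAME): tangent directions are the kernel of `D_W = dirIter L (j+1) W`. [folklore] -/
theorem dirIter_eq_zero_of_tangentIter (L j : ℕ) (W : Site d → Fin d → (Matrix n n ℂ)ˣ) (Y : Site d → Fin d → Matrix n n ℂ)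
    (h : TangentIter L j W Y) : dirIter L (j + 1) W Y = 0 :=
  (tangentIter_iff_dirIter_eq_zero L j W Y).mp h

/-- **Π-D ON FRAME-FREE FIELDS — THE STRAIGHT DECAY** (`L ≥ 2`, tower class): if `framePotW L (j+1) W Y = 0` then
`l2sq_{periodBox N} (dirIter L (j+1) W Y) ≤ 4·(L²∕L^d)^{j+1}·l2sq_{periodBox (tower L N (j+1))} Y` (`= 4·M^{2−d}·l2sq Y`, `M = L^{j+1}`). [folklore] -/
theorem l2sq_dirIter_le_of_frameFree [Nonempty n] {L N : ℕ} (hL : 2 ≤ L) (hN : 1 ≤ N) (j : ℕ)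
    {W : Site d → Fin d → (Matrix n n ℂ)ˣ} {x : ℝ} (hWu : IsUnitaryCfg W) (hWP : IsPeriodicCfg W ((tower L N (j + 1) : ℕ) : ℤ))
    (hx : 0 ≤ x) (hsm : LevelSmall d L j x) (hWx : SmallField W x)
    {Y : Site d → Fin d → Matrix n n ℂ} (hYs : IsSkewDir Y) (hYP : IsPeriodicDir Y ((tower L N (j + 1) : ℕ) : ℤ))
    (hF : framePotW L (j + 1) W Y = 0) :
    l2sq (periodBox (d := d) N) (dirIter L (j + 1) W Y)
      ≤ 4 * ((L : ℝ) ^ 2 / (L : ℝ) ^ d) ^ (j + 1) * l2sq (periodBox (d := d) (tower L N (j + 1))) Y := by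
  haveI : NeZero N := ⟨by omega⟩
  have hL1 : 1 ≤ L := by omega
  have hstruct := dirIter_eq_QbarIter_add_gaugeDir (M := N) hL1 j hWu hWP hx hsm hWx hYs hYP
  have hD : dirIter L (j + 1) W Y = QbarIter L (j + 1) W Y := by
    rw [hstruct]; funext z κ; simp [hF, gaugeDir]
  rw [hD]
  exact l2sq_QbarIter_succ_le_class hL hN j hWu hWP hx hsm hWx hYP

/-! ## §3 General fields: the two-term bound (the frame part does not decay) -/

/-- **Π-D IN GENERAL — THE TWO-TERM BOUND** (`3 ≤ d`, `2 ≤ L`, tower class):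
`l2sq_N (dirIter L (j+1) W Y) ≤ 8·(L²∕L^d)^{j+1}·l2sq Y + 8·d·(48·(d·L))·l2sq Y` — the straight part decays, the frame part is O(1) (and O(1) is sharp:
F-ne3leaf04g6-1). [folklore] -/
theorem l2sq_dirIter_le_two_term [Nonempty n] (hd : 3 ≤ d) {L N : ℕ} (hL : 2 ≤ L) (hN : 1 ≤ N) (j : ℕ)
    {W : Site d → Fin d → (Matrix n n ℂ)ˣ} {x : ℝ} (hWu : IsUnitaryCfg W) (hWP : IsPeriodicCfg W ((tower L N (j + 1) : ℕ) : ℤ))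
    (hx : 0 ≤ x) (hsm : LevelSmall d L j x) (hWx : SmallField W x)
    {Y : Site d → Fin d → Matrix n n ℂ} (hYs : IsSkewDir Y) (hYP : IsPeriodicDir Y ((tower L N (j + 1) : ℕ) : ℤ)) :
    l2sq (periodBox (d := d) N) (dirIter L (j + 1) W Y)
      ≤ 8 * ((L : ℝ) ^ 2 / (L : ℝ) ^ d) ^ (j + 1) * l2sq (periodBox (d := d) (tower L N (j + 1))) Y
        + 8 * (d : ℝ) * (48 * ((d : ℝ) * L)) * l2sq (periodBox (d := d) (tower L N (j + 1))) Y := by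
  haveI : NeZero N := ⟨by omega⟩
  have hL1 : 1 ≤ L := by omega
  have hstruct := dirIter_eq_QbarIter_add_gaugeDir (M := N) hL1 j hWu hWP hx hsm hWx hYs hYP
  obtain ⟨-, hFP⟩ := framePotW_skew_periodic (M := N) hL1 j hWu hWP hx hsm hWx hYs hYP
  have hUu : IsUnitaryCfg (cavgIter L (j + 1) W) := (cavgIter_unitary_small hL1 j hWu hx hsm hWx).1
  -- the two pieces
  have h1 := l2sq_QbarIter_succ_le_class hL hN j hWu hWP hx hsm hWx hYP
  have h2 := l2sq_gaugeDir_le hN hUu (f := framePotW L (j + 1) W Y) hFP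
  have hWP' : IsPeriodicCfg W ((L ^ (j + 1) * N : ℕ) : ℤ) := by rw [← tower_eq_pow_mul]; exact hWP
  have hYP' : IsPeriodicDir Y ((L ^ (j + 1) * N : ℕ) : ℤ) := by rw [← tower_eq_pow_mul]; exact hYP
  have h3 := sum_norm_framePotW_sq_le_class hd hL hN j hWu hWP' hx hsm hWx hYP'
  rw [← tower_eq_pow_mul] at h3
  have hS0 : 0 ≤ l2sq (periodBox (d := d) (tower L N (j + 1))) Y := l2sq_nonneg _ _
  rw [hstruct]
  calc l2sq (periodBox (d := d) N) (fun z κ => QbarIter L (j + 1) W Y z κ + gaugeDir (cavgIter L (j + 1) W) (framePotW L (j + 1) W Y) z κ)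
      ≤ 2 * l2sq (periodBox (d := d) N) (QbarIter L (j + 1) W Y)
          + 2 * l2sq (periodBox (d := d) N) (gaugeDir (cavgIter L (j + 1) W) (framePotW L (j + 1) W Y)) := l2sq_add_le _ _ _
    _ ≤ 2 * (4 * ((L : ℝ) ^ 2 / (L : ℝ) ^ d) ^ (j + 1) * l2sq (periodBox (d := d) (tower L N (j + 1))) Y)
          + 2 * (4 * (d : ℝ) * (48 * ((d : ℝ) * L) * l2sq (periodBox (d := d) (tower L N (j + 1))) Y)) := by
        refine add_le_add (mul_le_mul_of_nonneg_left h1 (by norm_num)) (mul_le_mul_of_nonneg_left (h2.trans ?_) (by norm_num))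
        exact mul_le_mul_of_nonneg_left h3 (by positivity)
    _ = _ := by ring

end

end Summit.QuantumFields.BalabanUV.T4Continuum.NE3LinearisedAverageL2
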